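import Literature.NumberTheory.EllipticCurves.MatsunoTwistedCurvesLocalProofs
import Literature.NumberTheory.EllipticCurves.KodairaNeronSplitHenselianProofs
import HarnessLib

/-!
# Matsuno 2009, §6: the local sentence of Corollary 6.3, proved unconditionally

Second `Proofs` companion of `Literature/NumberTheory/EllipticCurves/MatsunoTwistedCurves.lean`,
closing its named fact
`Literature.NumberTheory.EllipticCurves.Matsuno2009_sec6_splitMultiplicative` — the local
sentence in the proof of K. Matsuno, *Elliptic curves with large Tate–Shafarevich groups over a
number field*, Math. Res. Lett. 16 (2009), **Corollary 6.3** (p. 460): "`A_d` has split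
multiplicative reduction with even Tamagawa factor at each `q ∈ {ℓ₁, ⋯, ℓ_k, m₁, ⋯, m_k}` not
dividing `st`", for the twist `A_d` (`MatsunoTwistParams.curveAd`) of the curve (5)
`A : y² + xy = x³ + 8m x² + lm x` (`kramerCurveA m`, `l = 16m + 1`) by the `d` of Proposition 6.1
(`(d/q) = 1` for the odd primes `q ∣ Dlm`):

* `Matsuno2009_sec6_splitMultiplicative_holds : Matsuno2009_sec6_splitMultiplicative`.

`MatsunoTwistedCurvesLocalProofs.lean` proves the sentence up to its one external input, taken
there as the hypothesis `hKN` of `Matsuno2009_sec6_splitMultiplicative_of_kodairaNeron`: the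
Kodaira–Néron theorem for split multiplicative reduction over `ℤ_q` in the form of the named fact
`WeierstrassCurve.index_goodReductionSubgroup_of_hasSplitMultiplicativeReduction`
(`KodairaNeron.lean`; Silverman, *ATAEC* IV.9.2(d) with (b): `E(K)/E₀(K)` is cyclic of order
`v(Δ_min)` over a henselian ring). Only the ORDER half `[E(K) : E₀(K)] = v(Δ_min)` is used (to
see that `c_q(A_d) = v_q(Δ_min)` is even when `Δ(A_d) = (d³lm)²` is a square), and that half is
a THEOREM of the tree over any henselian discrete valuation ring,
`WeierstrassCurve.index_goodReductionSubgroup_eq_of_hasSplitMultiplicativeReduction`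
(`KodairaNeronSplitHenselianProofs.lean`, via the Tate normal form `y² + xy = x³ + απⁿ`). This
file substitutes the theorem for the hypothesis (`ℤ_q` is complete, hence henselian:
`IsAdicComplete.henselianRing`):

* `WeierstrassCurve.two_dvd_localTamagawaNumber_of_isSquare_Δ_of_henselian` — over a henselian
  discrete valuation ring, an elliptic curve whose minimal model has split multiplicative
  reduction and whose discriminant is a square has even Tamagawa number (unconditional form of
  `WeierstrassCurve.two_dvd_localTamagawaNumber_of_isSquare_Δ` of
  `QuadraticTwistPadicReduction.lean`);
* `WeierstrassCurve.two_dvd_localTamagawaNumber_padic_of_isSquare_Δ_of_hasSplit` — its `p`-adic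
  form for `E/ℚ` with `Δ_E ∈ ℚ²` at a prime of split multiplicative reduction;
* `Matsuno2009_sec6_splitMultiplicative_holds` — the assembly, verbatim that of
  `Matsuno2009_sec6_splitMultiplicative_of_kodairaNeron` (`q ∈ {ℓ_i} ∪ {m_j}` is an odd prime
  dividing `lm`, so `(d/q) = 1` makes `d` a `q`-adic square and `A_d ≅_{ℚ_q} A` is split
  multiplicative at `q` like `A`; `Δ(A_d)` is a square, so `c_q(A_d)` is even). The printed
  restriction "`q` not dividing `st`" is carried by the fact and not needed.

## References

* [Matsuno2009] K. Matsuno, Math. Res. Lett. 16 (2009), 449–461: §5, p. 456 ("`A` has split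
  multiplicative reduction at `ℓ₁, ⋯, ℓ_k, m₁, ⋯, m_k` (cf. [18, p. 383])"); §6, p. 460 (proof
  of Cor. 6.2: "the assumption `(d/q) = 1` implies the local condition at `q` … does not change
  by the quadratic twist"; proof of Cor. 6.3, first sentence, quoted above). Held, read
  (`paper:doi-10-4310-mrl-2009-v16-n3-a6`, PDF p. 12 = p. 460).
* [SilvermanATAEC1994] J. H. Silverman, *Advanced Topics in the Arithmetic of Elliptic Curves*,
  GTM 151 (1994), Cor. IV.9.2(b),(d) (PDF p. 340) (Kodaira–Néron).
* [SilvermanAEC2009] J. H. Silverman, *The Arithmetic of Elliptic Curves*, 2nd ed., VII.1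
  Prop. 1.3 (minimal models differ by `u ∈ R^×`), Thm. VII.6.1.
-/

noncomputable section

open scoped Classical

/-! ### Even Tamagawa numbers from a square discriminant over a henselian ring (unconditional) -/

namespace WeierstrassCurve

variable (R : Type*) [CommRing R] [IsDomain R] [IsDiscreteValuationRing R] {K : Type*}
  [Field K] [Algebra R K] [IsFractionRing R K]

/-- **Split multiplicative reduction with square discriminant has even Tamagawa number, over a
henselian discrete valuation ring** — the unconditional form of
`two_dvd_localTamagawaNumber_of_isSquare_Δ` (`QuadraticTwistPadicReduction.lean`), whose
Kodaira–Néron hypothesis `hKN` is replaced by the tree's theorem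
`index_goodReductionSubgroup_eq_of_hasSplitMultiplicativeReduction`
(`KodairaNeronSplitHenselianProofs.lean`: `[E(K) : E₀(K)] = v(Δ)` for a minimal split
multiplicative equation over a henselian `R`, any residue field; Silverman, *ATAEC*
Cor. IV.9.2(d) with (b)). If the chosen `R`-minimal model of the elliptic curve `W/K` has split
multiplicative reduction and `Δ(W)` is a square in `K`, then `2 ∣ c(W/K) = [E(K) : E₀(K)]`:
`c = v(Δ_min)` and `Δ_min = u⁻¹² Δ(W) = (u⁻⁶ r)²` for `W.minimal R = C • W`, `Δ(W) = r²`
(Silverman, *AEC* VII.1 Prop. 1.3). [cite: SilvermanATAEC1994, Cor. IV.9.2(d) with (b) (PDF p. 340)] -/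
theorem two_dvd_localTamagawaNumber_of_isSquare_Δ_of_henselian (W : WeierstrassCurve K)
    [W.IsElliptic] [HenselianRing R (IsLocalRing.maximalIdeal R)]
    (hsplit : (W.minimal R).HasSplitMultiplicativeReduction R) (hΔ : IsSquare W.Δ) :
    2 ∣ W.localTamagawaNumber R := by
  haveI := hsplit
  have hmin : W.minimal R = (W.exists_isMinimal R).choose • W := rfl
  haveI : (W.minimal R).IsElliptic := by
    rw [hmin]
    infer_instance
  obtain ⟨-, hv⟩ :=
    (W.minimal R).index_goodReductionSubgroup_eq_of_hasSplitMultiplicativeReduction R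
  -- `Δ_min = (u⁻⁶ r)²`
  obtain ⟨r, hr⟩ := hΔ
  set z : K := ((((W.exists_isMinimal R).choose).u⁻¹ : Kˣ) : K) ^ 6 * r with hz
  have hΔmin : (W.minimal R).Δ = z * z := by
    rw [hmin, variableChange_Δ, hr, hz]
    ring
  have hr0 : r ≠ 0 := by
    rintro rfl
    exact W.isUnit_Δ.ne_zero (hr.trans (mul_zero 0))
  have hz0 : z ≠ 0 := mul_ne_zero (pow_ne_zero _ (Units.ne_zero _)) hr0
  have hvz : IsDedekindDomain.HeightOneSpectrum.valuation K
      (IsDiscreteValuationRing.maximalIdeal R) z ≠ 0 := (Valuation.ne_zero_iff _).mpr hz0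
  -- `v(Δ_min) = exp (-c)` (Kodaira–Néron), and `v(Δ_min) = v(z)² = exp (2 log v(z))`
  rw [hΔmin, Valuation.map_mul, ← WithZero.exp_log hvz, ← WithZero.exp_add,
    WithZero.exp_inj] at hv
  unfold localTamagawaNumber
  omega

variable {R}

/-- **`p`-adic form, unconditional**: for an elliptic curve `E/ℚ` whose discriminant is a
square in `ℚ` and a prime `q` of split multiplicative reduction
(`HasSplitMultiplicativeReductionAtPrime`), the Tamagawa factor
`c_q(E) = [E(ℚ_q) : E₀(ℚ_q)]` (`localTamagawaNumber` of `E ⊗ ℚ_q` over `ℤ_q`) is even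
(`ℤ_q` is complete, hence henselian: `IsAdicComplete.henselianRing`). Unconditional form of
`two_dvd_localTamagawaNumber_padic_of_isSquare_Δ`.
[cite: SilvermanATAEC1994, Cor. IV.9.2(d) with (b) (PDF p. 340)] -/
theorem two_dvd_localTamagawaNumber_padic_of_isSquare_Δ_of_hasSplit (E : WeierstrassCurve ℚ)
    [E.IsElliptic] {q : ℕ} [Fact q.Prime] (hsplit : E.HasSplitMultiplicativeReductionAtPrime q)
    (hΔ : IsSquare E.Δ) : 2 ∣ (E.baseChange ℚ_[q]).localTamagawaNumber ℤ_[q] := by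
  haveI : (E.baseChange ℚ_[q]).IsElliptic :=
    inferInstanceAs (E.map (algebraMap ℚ ℚ_[q])).IsElliptic
  refine two_dvd_localTamagawaNumber_of_isSquare_Δ_of_henselian ℤ_[q] (E.baseChange ℚ_[q])
    hsplit ?_
  obtain ⟨r, hr⟩ := hΔ
  exact ⟨algebraMap ℚ ℚ_[q] r, by rw [baseChange, map_Δ, hr, map_mul]⟩

end WeierstrassCurve

/-! ### The local sentence of Corollary 6.3, proved -/

namespace Literature.NumberTheory.EllipticCurves

-- `_root_`: the import chain declares `Literature.NumberTheory.EllipticCurves.WeierstrassCurve.*`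
-- (`ReductionHomomorphism.lean`), which would otherwise shadow Mathlib's namespace here.
open _root_.WeierstrassCurve

/-- **Matsuno 2009, the local sentence of the proof of Corollary 6.3, PROVED**: "`A_d` has split
multiplicative reduction with even Tamagawa factor at each `q ∈ {ℓ₁, ⋯, ℓ_k, m₁, ⋯, m_k}` not
dividing `st`" (p. 460, first sentence of the proof of Cor. 6.3; with p. 456 "`A` has split
multiplicative reduction at `ℓ₁, ⋯, ℓ_k, m₁, ⋯, m_k` (cf. [18, p. 383])" and p. 460, proof of
Cor. 6.2, "the assumption `(d/q) = 1` implies the local condition at `q` … does not change by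
the quadratic twist") — the named fact `Matsuno2009_sec6_splitMultiplicative` of
`MatsunoTwistedCurves.lean`, unconditionally. Same proof as
`Matsuno2009_sec6_splitMultiplicative_of_kodairaNeron`: `q ∈ {ℓ_i} ∪ {m_j}` is an odd prime
dividing `lm` (`ne_two_and_dvd_of_mem_pivots`), so `(d/q) = 1` (hypothesis of Prop. 6.1) makes
`d` a square in `ℚ_q` (`padic_isSquare_of_jacobiSym_eq_one`); `A` is split multiplicative at
`q` (`hasSplitMultiplicativeReductionAtPrime_curveA`, using (A1) at the `ℓ_i`), hence so is
`A_d ≅_{ℚ_q} A` (`hasSplitMultiplicativeReductionAtPrime_quadraticTwist_iff`); and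
`Δ(A_d) = (d³lm)²` is a square, so `c_q(A_d) = v_q(Δ_min)` is even — the Kodaira–Néron input
being the tree's theorem over the complete ring `ℤ_q`
(`two_dvd_localTamagawaNumber_padic_of_isSquare_Δ_of_hasSplit`). The hypothesis `q ∤ st` is
not used. [cite: Matsuno2009, proof of Corollary 6.3 (p. 460, first sentence)]
[cite: SilvermanATAEC1994, Cor. IV.9.2(d) with (b) (PDF p. 340)] -/
theorem Matsuno2009_sec6_splitMultiplicative_holds : Matsuno2009_sec6_splitMultiplicative := by
  intro K _ _ _ _hK k P d hsq _hω _hd8 hJ q _ hq _hst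
  have hqp : q.Prime := Fact.out
  have hd0 : d ≠ 0 := by
    rintro rfl
    exact not_squarefree_zero hsq
  obtain ⟨hq2, hqdvd⟩ := P.ne_two_and_dvd_of_mem_pivots hq (NumberField.discr K)
  -- `d` is a square in `ℚ_q`
  have hsqq : IsSquare (algebraMap ℚ ℚ_[q] ((d : ℤ) : ℚ)) := by
    rw [map_intCast]
    exact padic_isSquare_of_jacobiSym_eq_one hq2 (hJ q hqp hq2 hqdvd)
  -- `A_d` is split multiplicative at `q`, as `A` is
  haveI := P.isElliptic_curveA
  have hAd : (P.curveAd d).HasSplitMultiplicativeReductionAtPrime q := by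
    rw [MatsunoTwistParams.curveAd, hasSplitMultiplicativeReductionAtPrime_quadraticTwist_iff
      P.curveA (by exact_mod_cast hd0) hsqq]
    exact P.hasSplitMultiplicativeReductionAtPrime_curveA hq
  -- and its Tamagawa factor is even, `Δ(A_d)` being a square (Kodaira–Néron over `ℤ_q`)
  haveI := P.isElliptic_curveAd hd0
  exact ⟨hAd, two_dvd_localTamagawaNumber_padic_of_isSquare_Δ_of_hasSplit (P.curveAd d) hAd
    (P.isSquare_curveAd_Δ d)⟩

end Literature.NumberTheory.EllipticCurves

end
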